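import Literature.MathematicalPhysics.QuantumFieldTheory.Balaban1983to89.B9Thm310GOfLocalInverseCubes
import Literature.MathematicalPhysics.QuantumFieldTheory.Balaban1983to89.B9Thm34InvBlk

/-!
# `Balaban1983to89.B9Thm310DeltaAIsUnitOfExpansion` — T. Bałaban, *Propagators for lattice gauge theories in a background field*, Commun. Math. Phys. **99**
# (1985) 389–434 [Balaban1985BackgroundPropagators], (3.106) p. 414 «For M sufficiently large this implies G = G₀(I − R)⁻¹»: the INVERTIBILITY OF `Δ_a(U₁)`
# DERIVED from the smallness of the (3.105) remainder — the displayed hypothesis `hinvU : IsUnit Δ_a(U₁)` of module M5.7's endpoints DISCHARGED from the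
# expansion's own inputs (cell `lit-balaban`, sub-row G-B9-LETTERS, module M5.7, sequel of the (QB1) re-cut; seat p38 gen 41)

statement-level skeleton of published theorems with citation tags; proofs where landed; nothing here is a claim about the Yang–Mills mass gap

CITATION HEADER (lean-in-tree rule).  B9 = T. Bałaban, *Propagators for lattice gauge theories in a background field*, Commun. Math. Phys. **99** (1985)
389–434 (PDF held: `paper:balaban1985-cmp99-background-propagators`, journal page = PDF page + 388).  p. 414 (3.105) «Δ_aG₀ = I − Σ_□K(h_□)G_□h_□ −
Σ_□(1 − ζ_□̃)DPD*h_□G_□h_□ − Σ_□ζ_□̃(DPD* − DP_□D*)h_□G_□h_□ − Σ_□ζ_□̃P_{□,1}(∂h_□)G_□h_□ = I − R», p. 414 l. 33–35 «The operator K(h_□)G_□h_□ satisfies the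
inequality (3.89), hence it is small», «More exactly, it will follow from this analysis that R satisfies the bound (3.85) with O(M⁻¹) instead of O(α₁). For M
sufficiently large this implies G = G₀(I − R)⁻¹ = Σ_{n=0}^∞ G₀Rⁿ. (3.106)»; p. 416 Theorem 3.10 «For M sufficiently large, and a configuration U satisfying (3.95),
the operator G can be represented …», «Theorem 3.10 implies Theorem 3.3»; (3.27) p. 395 «G(U) = Δ_a(U)⁻¹»; p. 403 (3.67) «thus the operators in the equality are
invertible» (the same maximum-principle device for `I + C′(A)C⁻¹(U)`).  [4] = [Balaban1984PropagatorsII] (2.51)–(2.52) p. 232, Lemma 2.1 (2.61) p. 234, (2.66) p. 234.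
Rows B9.Eq3.106 × B9.Thm3.10 × B9.Thm3.3 (cells only; no row head changes).

WHY THIS FILE.  Every endpoint of module M5.7 (`B9Thm310GTorusRegularCover*`, `B9Thm310TransposedCommutatorBMajorant`, and the (QB1) re-cut
`B9Thm310GOfLocalInverse(Cubes)`) displays `hinvU : IsUnit (Δ_a(U₁))` — the existence of def-Y's `G(U₁) = Δ_a(U₁)⁻¹` (Thm 3.3's regime; M5.3 lineage), for which the
cell has no proof road at a class background (r05 g83, 2026-08-28 11:28:22Z (c): positivity of the covariant `Δ_a` at `U₁` is a gauge-invariant question, expected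
true, unproved).  But print's (3.106) gives existence for free once `R` is small: `Δ_a·G₀(I − R)⁻¹ = I`, a RIGHT inverse, hence (finite lattice) a two-sided one.  THIS
FILE formalizes exactly that with the expansion's OWN displayed inputs: the real-coordinate remainder `R` (five families: the first discharged by
`B9Thm310GOfLocalInverse.hasMajorant_sum_conj_KhBY_Oc_hTY`, families 2–4 + the defect family displayed as `hrest`) has a block majorant `(Θ₁ + Θ′)e^{−δ₀d}` with
`(Θ₁ + Θ′)c₁(α) < 1`, so its matrix has ℓ¹ row sums `< 1` ([4] (2.61); r06's dictionary `B9Thm34InvBlk.hasMajorant_blk_iff`), `I − R` is a unit by the maximum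
principle on the finite carrier (r06's `B9Thm34Inv.isUnit_one_add_of_rowSum`), `G₀(I − R)⁻¹` is a right inverse of `conj b Δ_a(U₁)` (b09's
`B9Eq3105Sum.eq3106_rightInverse` on `B9Eq3105OfLocalInverse.eq3105_conj_defect`), two-sided by `B9Eq3105Sum.eq3106_twoSided`, and invertibility transfers back
through the coordinates of the basis `b` (`Module.End.isUnit_iff`).  Consequence: the (QB1) endpoints WITHOUT `hinvU`.

WHAT IS PROVED (all `theorem`s, 0 `def`, 0 sorry, 0 new named facts).
* §1 (devices, any finite block carrier) `rowSum_le_of_hasMajorant` ([4] (2.61) ⇒ ℓ¹ row sums `≤ θc₁(r, α′)` from a block majorant `θe^{−r·d}`, needing only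
  `0 ≤ (1 − α′)r`), ★ `isUnit_one_sub_of_hasMajorant` (`θc₁ < 1 ⇒ IsUnit (1 − R)`), ★ `isUnit_of_conj_mul_eq_one_sub` (`conj b Δ · G₀ = 1 − R`, `IsUnit (1 − R)` ⇒
  `IsUnit Δ` in `End_ℂ`).
* §2 ★★ `isUnit_deltaAY_of_localInverse` — `IsUnit (Δ_a(U₁))` from the (3.105) data at an arbitrary cube-letter family `O_□` (left defect law `hdef`, (3.101) law
  `hP1`, the letters' (3.42) blocks `hE`, bi-contractivity, `η = |c_f|⁻¹`, the plaquette datum, `hrest`, (2.61), `(Θ₁ + Θ′)c₁(α) < 1`).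
* §3 ★★★ `eBlock_kernelFamilyBInv_GAY_of_localInverseCubes''` and `…''_exact` — `B9Thm310GOfLocalInverseCubes.eBlock_kernelFamilyBInv_GAY_of_localInverseCubes'` ∕
  `…'_exact` with `hinvU` DISCHARGED (no other change).
* §4 (v1.1, at r05's whole-torus cube letters `GACubeY` — the consumer shape of `B9Thm310TransposedCommutatorBMajorant.eBlock_kernelFamilyBInv_GAY_of_coverCubes'`)
  ★★ `isUnit_deltaAY_of_coverCubes` — `IsUnit (Δ_a(U₁))` from `hinvC : ∀ □, IsUnit Δ_{a,□}(U₁)` (r05's letter `G_{a,□} = Δ_{a,□}⁻¹` is then an exact local inverse: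
  `B9Eq3105OfLocalInverse.hdef_GACubeY`, `hP1_DPDsCubeY`) + the displayed inputs of that consumer (`hE` at `GACubeY`, `hU`∕`hT`, `hW`, `hrest` with families 2–4 at
  `GACubeY`∕`DPDsCubeY`∕`P1CubeY`, (2.61), `(Θ₁ + Θ′)c₁(α) < 1`); ★★★ `eBlock_kernelFamilyBInv_GAY_of_coverCubes''` — the landed consumer
  `…TransposedCommutatorBMajorant.eBlock_kernelFamilyBInv_GAY_of_coverCubes'` VERBATIM with `hinvU` REMOVED (via `…''_exact` at `Oc □ := GACubeY i □ parS parB`, exact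
  laws from `B9Eq3105AtLetters.hloc_GACubeY` ∕ `B9Eq3105TAtLetters.hlocT_GACubeY` and the NearH agreements `B9CubeBondRowAgreementNearH.QsaQCubeY_apply_eq_of_hT` ∕
  `B9Eq3105TAtLettersNearH.QsaQCubeY_cutMulY_hT_apply_eq`) — which also certifies, kernel-checked, that the (QB1) re-cut generalises the landed consumer.

HONEST SCOPE.  Nothing new is assumed: the inputs are those of the (QB1) endpoint minus `hinvU`.  The smallness `(Θ₁ + Θ′)c₁(α) < 1` («M sufficiently large») and
the families 2–4 majorant `hrest` (cell GAPS G-B9-05∕06a∕07) stay displayed; the defect family is an (R)-design term, NOT in print (`= 0` for print's letters and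
r05's `GACubeY`).  The invertibility obtained is that of def-Y's `Δ_a(U₁) = deltaAY i parS parB Gp (cfg U₁)` for the GIVEN site-sector letter `Gp` entering `R(U₁)`
((3.25)–(3.26)); it says nothing about positivity.  Nothing continuum ∕ OS ∕ mass gap ∕ Clay; YM mass gap NOT proved by any of this (Track A conditional rung).
`--supports stmt-QuantumFields-19200`.  RELATED, NOT DUPLICATED (searched 2026-08-28: `lean search 'isUnit_deltaAY|isUnit_one_sub_of_hasMajorant' --decl` — r05's
`B9Thm311CubeLettersG*.isUnit_deltaACubeY_*` (cube letter, small-field ∕ pure-gauge regimes, by positivity) are different statements; `B9Eq3105Sum.eq3106_*` are the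
ring-level halves used here).
-/

noncomputable section

namespace Literature.MathematicalPhysics.QuantumFieldTheory.Balaban1983to89.B9Thm310DeltaAIsUnitOfExpansion

open Node00 B9CubeLettersInvReadings
open B6GlobalChartV1 (blkV1)
open B6Ineq2142KLevelV1 (β)
open B6KLevelCensusIndexV1 (KIdx)
open B6Cover236MultiLevelBlocks (cubes)
open B6Partition118KLevelFineSizes (C1F C1F_nonneg)
open B6Partition118KLevelFineSecond (C2F C2F_nonneg)
open B6Partition118KLevelFineMixed (C2X C2X_bounds)
open B6Partition118KLevelTorusBinders (sLipT sLipT_nonneg)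
open B6RandomWalk (HasMajorant Ineq261 Ineq263 hasMajorant_mono hasMajorant_add c1_nonneg)
open B9Thm34Ext (toB6 toB6_dist)
open B9FromB6 (EBlock)
open B9GeoNormsKLevelV1 (geo9K)
open B9Eq352DivFormLetters (conj coordEquiv)
open B9Thm37Sum (mulOp)
open B9Thm37CubeCoverCommutators (cutMulY hTY)
open B9Eq3104CutoffCommutators (hBdY KhBY DPDsY deltaLocY)
open B9Thm34Inv (entry isUnit_one_add_of_rowSum)
open B9Thm34InvBlk (hasMajorant_blk_iff hasMajorant_neg_blk)
open B9Eq3105Sum (eq3106_rightInverse eq3106_twoSided)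
open B9Eq3105OfLocalInverse (eq3105_conj_defect hdef_GACubeY hP1_DPDsCubeY)
open B9CubeLettersBondOpsL0 (deltaACubeY GACubeY)
open B9Eq3105AtLetters (DPDsCubeY P1CubeY hloc_GACubeY)
open B9Eq3105TAtLetters (hlocT_GACubeY)
open B9CubeBondRowAgreementNearH (QsaQCubeY_apply_eq_of_hT)
open B9Eq3105TAtLettersNearH (QsaQCubeY_cutMulY_hT_apply_eq)
open B9Thm310CommutatorBound389B (theta389B theta389B_nonneg)
open B9Thm310GOfLocalInverse (hasMajorant_add5_of_head hasMajorant_sum_conj_KhBY_Oc_hTY)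
open B9Thm310GOfLocalInverseCubes (eBlock_kernelFamilyBInv_GAY_of_localInverseCubes' eBlock_kernelFamilyBInv_GAY_of_localInverseCubes'_exact)
open Node00.OpsYNablaBridge (chartY)
open scoped Matrix

/-! ## §1 Devices: row sums from a block majorant, `I − R` a unit, invertibility through the coordinates -/

section Device

variable {g : B9.Geometry} [Fintype g.Site] [DecidableEq g.Site] {R : ℝ} {H : Prop}
variable {P : Type} [Fintype P] [DecidableEq P]

/-- **ℓ¹ ROW SUMS FROM A BLOCK MAJORANT** `θe^{−r·d(y,y′)}` and [4] (2.61) at `(r, α′)` with `0 ≤ (1 − α′)r`: `Σ_{p′∈P} |R(δ_{p′})(p)| ≤ θc₁(r, α′)` — r06's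
`B9Thm34InvBlk.rowSum_le_of_majorant_blk` with its side conditions `α′ ≤ 1`, `0 ≤ r` merged into the one product actually used (so that the cell's displayed
`0 ≤ (1 − α)δ₀` suffices). [cite: Balaban1984PropagatorsII, (2.61) p.234 + (2.51) p.232] -/
theorem rowSum_le_of_hasMajorant (blkP : P → g.Site) (d : ℕ) (r α' θ : ℝ) (hθ : 0 ≤ θ) (hαr : 0 ≤ (1 - α') * r)
    (hdnn : ∀ a b : g.Site, 0 ≤ g.dist a b) (h261 : Ineq261 d (toB6 g R H) r α')
    {E : Module.End ℝ (P → ℝ)}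
    (hE : HasMajorant (g := toB6 g R H) blkP E (fun a b => θ * Real.exp (-(r * g.dist a b)))) :
    ∀ p : P, ∑ p' : P, |entry E p p'| ≤ θ * B6.c1 d r α' := by
  intro p
  have h := (hasMajorant_blk_iff (R := R) (H := H) blkP _ _).mp hE
  rw [← Finset.sum_fiberwise_of_maps_to (s := (Finset.univ : Finset P)) (t := (Finset.univ : Finset g.Site)) (g := blkP)
    (fun _ _ => Finset.mem_univ _) (fun p' => |entry E p p'|)]
  calc ∑ y' : g.Site, ∑ p' ∈ Finset.univ.filter (fun p' => blkP p' = y'), |entry E p p'|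
      ≤ ∑ y' : g.Site, θ * Real.exp (-(α' * r * g.dist (blkP p) y')) := by
        refine Finset.sum_le_sum fun y' _ => (h p y').trans (mul_le_mul_of_nonneg_left ?_ hθ)
        refine Real.exp_le_exp.mpr ?_
        have := mul_nonneg hαr (hdnn (blkP p) y')
        nlinarith
    _ = θ * ∑ y' : g.Site, Real.exp (-(α' * r * g.dist (blkP p) y')) := by rw [Finset.mul_sum]
    _ ≤ θ * B6.c1 d r α' := mul_le_mul_of_nonneg_left (h261 (blkP p)) hθ

/-- ★ **`I − R` IS A UNIT WHEN `R` HAS A SMALL BLOCK MAJORANT** (p. 414 «For M sufficiently large this implies G = G₀(I − R)⁻¹»; the device of p. 403 «thus the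
operators in the equality are invertible»): a block majorant `θe^{−r·d}` of `R`, [4] (2.61) at `(r, α′)`, `0 ≤ (1 − α′)r`, and `θc₁(r, α′) < 1` give `IsUnit (1 − R)` —
row sums `< 1` (`rowSum_le_of_hasMajorant` on `−R`) and the maximum principle on the finite carrier (r06's `B9Thm34Inv.isUnit_one_add_of_rowSum`).
[cite: Balaban1985BackgroundPropagators, (3.106) p.414, (3.67) p.403; Balaban1984PropagatorsII, (2.61) p.234, (2.66) p.234] -/
theorem isUnit_one_sub_of_hasMajorant (blkP : P → g.Site) (d : ℕ) (r α' θ : ℝ) (hθ : 0 ≤ θ) (hαr : 0 ≤ (1 - α') * r)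
    (hdnn : ∀ a b : g.Site, 0 ≤ g.dist a b) (h261 : Ineq261 d (toB6 g R H) r α') (hsmall : θ * B6.c1 d r α' < 1)
    {Rt : Module.End ℝ (P → ℝ)}
    (hR : HasMajorant (g := toB6 g R H) blkP Rt (fun a b => θ * Real.exp (-(r * g.dist a b)))) :
    IsUnit (1 - Rt) := by
  rw [sub_eq_add_neg]
  exact isUnit_one_add_of_rowSum (-Rt) _ hsmall
    (rowSum_le_of_hasMajorant (R := R) (H := H) blkP d r α' θ hθ hαr hdnn h261 (hasMajorant_neg_blk (R := R) (H := H) blkP hR))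

end Device

section Coordinates

variable {𝔸 : Type} [NormedRing 𝔸] [NormedAlgebra ℂ 𝔸] [CompleteSpace 𝔸]
variable {ι : Type} [Fintype ι]
variable {S : Type} [Fintype S]
variable (b : Module.Basis ι ℝ 𝔸)

omit [CompleteSpace 𝔸] in
/-- ★ **INVERTIBILITY THROUGH THE COORDINATES**: if the real-coordinate letter of a ℂ-linear `Δ` has a right inverse of the (3.106) shape — `conj b Δ · G₀ = 1 − R`
with `1 − R` a unit — then `Δ` itself is a unit of `End_ℂ`: `G₀(1 − R)⁻¹` is a right inverse (b09's `eq3106_rightInverse`), two-sided on the finite carrier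
(`eq3106_twoSided`), and bijectivity passes through the coordinate isomorphism of the basis `b` (`Module.End.isUnit_iff`). [cite: Balaban1985BackgroundPropagators, (3.106) p.414, (3.27) p.395; Balaban1984PropagatorsII, (2.52) p.232] -/
theorem isUnit_of_conj_mul_eq_one_sub (Δ : Module.End ℂ (S → 𝔸)) {G0 Rt : Module.End ℝ (S × ι → ℝ)}
    (h105 : conj b (Δ.restrictScalars ℝ) * G0 = 1 - Rt) (hu : IsUnit (1 - Rt)) : IsUnit Δ := by
  obtain ⟨u, hu⟩ := hu
  have hright : conj b (Δ.restrictScalars ℝ) * (G0 * ↑u⁻¹) = 1 := eq3106_rightInverse h105 u hu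
  have hleft : (G0 * ↑u⁻¹) * conj b (Δ.restrictScalars ℝ) = 1 := eq3106_twoSided hright
  have hunit : IsUnit (conj b (Δ.restrictScalars ℝ)) := ⟨⟨_, _, hright, hleft⟩, rfl⟩
  have hbij := (Module.End.isUnit_iff _).mp hunit
  have hfun : ⇑(Δ.restrictScalars ℝ) = ⇑(coordEquiv b).symm ∘ ⇑(conj b (Δ.restrictScalars ℝ)) ∘ ⇑(coordEquiv b) := by
    funext f
    simp only [Function.comp_apply, B9Eq352DivFormLetters.conj, LinearEquiv.conj_apply_apply, LinearEquiv.symm_apply_apply]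
  have hbijR : Function.Bijective (Δ.restrictScalars ℝ) := by
    rw [hfun]
    exact (coordEquiv b).symm.bijective.comp (hbij.comp (coordEquiv b).bijective)
  exact (Module.End.isUnit_iff Δ).mpr hbijR

end Coordinates

variable {d ℓ : ℕ} {hd : 1 ≤ d + 1} {hL : Odd (ℓ + 1) ∧ 1 < ℓ + 1} {b₀ b₁ : ℝ}
variable {𝔸 : Type} [NormedRing 𝔸] [NormedAlgebra ℂ 𝔸] [CompleteSpace 𝔸]
variable {ι : Type} [Fintype ι] [DecidableEq ι]
variable (i : KIdx d ℓ hd hL b₀ b₁) (b : Module.Basis ι ℝ 𝔸)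
variable [Fintype (geo9K i).Site] [DecidableEq (geo9K i).Site] {Rr : ℝ} {Hp : Prop}
variable (ιB : BlkY i → IBondY i)
variable {B : B9.Backgrounds} (cfg : B.Cfg → CfgY 𝔸 i) (par : BondParY 𝔸 i) {U₁ : B.Cfg}

/-! ## §2 `Δ_a(U₁)` is invertible when the (3.105) remainder is small -/

section DeltaA

/-- ★★ **`IsUnit (Δ_a(U₁))` FROM THE EXPANSION** (p. 414 «For M sufficiently large this implies G = G₀(I − R)⁻¹»): at the cube cover of record with an ARBITRARY
cube-letter family `O_□` obeying the left defect law `hdef` and the (3.101) law `hP1`, the letters' (3.42) blocks `hE` at `U₁`, bi-contractivity `hU`∕`hT`,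
`η = |c_f|⁻¹`, the plaquette datum `hW`, the displayed majorant `Θ′e^{−δ₀d}` of families 2–4 of `R` plus the defect family (`hrest`), [4] (2.61) at `(δ₀, α)` with
`0 ≤ αδ₀`, `0 ≤ (1 − α)δ₀`, and the located smallness `(Θ₁ + Θ′)c₁(α) < 1`, def-Y's `Δ_a(U₁) = deltaAY i parS parB Gp (cfg U₁)` is a unit of `End_ℂ` — so the
hypothesis `hinvU` of the M5.7 endpoints is a CONSEQUENCE of their other inputs.  DEFECT LABEL: the defect family `Σ_□E_□` is an (R)-design term, NOT in print; `= 0`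
for print's `G_□ = (Δ_{loc,□} − DP_□D*)⁻¹` on the cube sequence (p. 409 l. 3–5) and for r05's `GACubeY` letters.
[cite: Balaban1985BackgroundPropagators, (3.106) p.414, (3.105) p.414, Thm 3.10 p.416, (3.27) p.395; Balaban1984PropagatorsII, (2.61) p.234, (2.66) p.234] -/
theorem isUnit_deltaAY_of_localInverse (hι : ∀ s, β i.hN i.D i.hk (ιB s) = s)
    {M₂ : ℝ} (hM₂ : 0 ≤ M₂) (hrepr : ∀ (v : 𝔸) (j : ι), |b.repr v j| ≤ M₂ * ‖v‖) (hη : etaS i = |i.cf|⁻¹) (hb₁ : 0 ≤ b₁)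
    (d' : ℕ) {δ₀ α Θ' B₀ δh : ℝ}
    (parS : SiteParY 𝔸 i) (parB : BondParY 𝔸 i) (Gp : SiteOpY 𝔸 i)
    (ζ : ↥(cubes i.D.toDomains) → SiteY i → ℝ) (hζ : ∀ c z, hTY i c z ≠ 0 → ζ c z = 1)
    (Oc : ↥(cubes i.D.toDomains) → BondOpY 𝔸 i) (Pl P1l E : ↥(cubes i.D.toDomains) → Module.End ℂ (FBondY i → 𝔸))
    (hP1 : ∀ c, Pl c * cutMulY (hBdY i (hTY i c)) = cutMulY (hBdY i (hTY i c)) * Pl c + P1l c)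
    (hdef : ∀ c, cutMulY (hBdY i (hTY i c)) * (deltaLocY i parB (cfg U₁) - Pl c) * Oc c (cfg U₁) * cutMulY (hBdY i (hTY i c)) =
      cutMulY (hBdY i (hTY i c)) * cutMulY (hBdY i (hTY i c)) - E c)
    (hB₀ : 0 ≤ B₀) (hδ₀ : 0 ≤ δ₀) (hΘ' : 0 ≤ Θ') (hδh : 0 ≤ δh) (hαδ : 0 ≤ α * δ₀) (hαδ1 : 0 ≤ (1 - α) * δ₀)
    (h261 : Ineq261 d' (toB6 (geo9K i) Rr Hp) δ₀ α)
    (hsmall : ((3 * 5 ^ (d + 1) * (Real.exp (α * δ₀ * (2 * (ℓ : ℝ) + 6)) * B6.c1 d' δ₀ α)) *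
        (M₂ * (∑ j, ‖b j‖) * theta389B d ℓ B₀ b₁ δ₀ 1 (2 * δh) (δh * (((ℓ : ℝ) + 1) ^ 2 + 1)) δh 0 * ((geo9K i).M)⁻¹) + Θ') * B6.c1 d' δ₀ α < 1)
    (hE : ∀ c : ↥(cubes i.D.toDomains), EBlock (kernelFamilyBInv i B cfg (Oc c) par) B₀ δ₀ U₁)
    (hU : ∀ μ x, ‖(cfg U₁ μ x : 𝔸)‖ ≤ 1 ∧ ‖(((cfg U₁ μ x)⁻¹ : 𝔸ˣ) : 𝔸)‖ ≤ 1)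
    (hT : ∀ (y : IBondY i) (f : FBondY i), ‖(qT i parB (cfg U₁) y f : 𝔸)‖ ≤ 1 ∧ ‖(((qT i parB (cfg U₁) y f)⁻¹ : 𝔸ˣ) : 𝔸)‖ ≤ 1)
    (hW : ∀ p : PlaqY i, ‖((holY i (cfg U₁) p : 𝔸ˣ) : 𝔸) - 1‖ ≤ δh * ((((ℓ : ℝ) + 1) ^ levY i (chartY i p.src))⁻¹) ^ 2)
    (hrest : HasMajorant (g := toB6 (geo9K i) Rr Hp) (fun p : FBondY i × ι => ιB (blkV1 i.hN i.D p.1))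
      (∑ c, conj b (((1 - cutMulY (hBdY i (ζ c))) * DPDsY i parS Gp (cfg U₁) *
            (cutMulY (hBdY i (hTY i c)) * Oc c (cfg U₁) * cutMulY (hBdY i (hTY i c)))).restrictScalars ℝ)
        + ∑ c, conj b ((cutMulY (hBdY i (ζ c)) * (DPDsY i parS Gp (cfg U₁) - Pl c) *
            (cutMulY (hBdY i (hTY i c)) * Oc c (cfg U₁) * cutMulY (hBdY i (hTY i c)))).restrictScalars ℝ)
        + ∑ c, conj b ((cutMulY (hBdY i (ζ c)) * P1l c * Oc c (cfg U₁) * cutMulY (hBdY i (hTY i c))).restrictScalars ℝ)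
        + ∑ c, conj b ((E c).restrictScalars ℝ))
      (fun a a' => Θ' * Real.exp (-(δ₀ * (geo9K i).dist a a')))) :
    IsUnit (deltaAY i parS parB Gp (cfg U₁)) := by
  classical
  have hSb : 0 ≤ ∑ j, ‖b j‖ := Finset.sum_nonneg fun _ _ => norm_nonneg _
  have hΘ₁ : 0 ≤ (3 * 5 ^ (d + 1) * (Real.exp (α * δ₀ * (2 * (ℓ : ℝ) + 6)) * B6.c1 d' δ₀ α)) *
      (M₂ * (∑ j, ‖b j‖) * theta389B d ℓ B₀ b₁ δ₀ 1 (2 * δh) (δh * (((ℓ : ℝ) + 1) ^ 2 + 1)) δh 0 * ((geo9K i).M)⁻¹) :=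
    mul_nonneg (mul_nonneg (by positivity) (mul_nonneg (Real.exp_nonneg _) (c1_nonneg d' δ₀ α)))
      (mul_nonneg (mul_nonneg (mul_nonneg hM₂ hSb) (theta389B_nonneg d ℓ hB₀ hb₁ zero_le_one (by positivity) (by positivity) hδh δ₀ 0))
        (inv_nonneg.2 (B9GeoLemma21KLevelV1.geo9K_M_nonneg i)))
  -- the whole remainder's block majorant `(Θ₁ + Θ′)e^{−δ₀d}` (first family proved, the rest displayed)
  have hR := hasMajorant_add5_of_head _
    (hasMajorant_sum_conj_KhBY_Oc_hTY i b ιB cfg par (Rr := Rr) (Hp := Hp) hι hM₂ hrepr hη Oc parB hB₀ hδ₀ hE hU hT hδh hW d' hαδ h261) hrest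
  -- `1 − R` is a unit: row sums `< 1` by (2.61) and the located smallness
  have hu := isUnit_one_sub_of_hasMajorant (R := Rr) (H := Hp) (fun p : FBondY i × ι => ιB (blkV1 i.hN i.D p.1)) d' δ₀ α _
    (add_nonneg hΘ₁ hΘ') hαδ1 (B9GeoLemma21KLevelV1.geo9K_dist_nonneg' i) h261 hsmall hR
  -- (3.105) in real coordinates gives the right inverse of the (3.106) shape
  exact isUnit_of_conj_mul_eq_one_sub b (deltaAY i parS parB Gp (cfg U₁))
    (eq3105_conj_defect i b parS parB Gp (cfg U₁) ζ hζ (fun c => Oc c (cfg U₁)) Pl P1l E hP1 hdef) hu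

end DeltaA

/-! ## §3 The (QB1) endpoints without the displayed invertibility of `Δ_a(U₁)` -/

section Endpoint

/-- ★★★ **THE (QB1) ENDPOINT WITH `hinvU` DISCHARGED**: `B9Thm310GOfLocalInverseCubes.eBlock_kernelFamilyBInv_GAY_of_localInverseCubes'` verbatim except that
`IsUnit (Δ_a(U₁))` is no longer displayed — it follows from the other inputs by §2 (print p. 414 «For M sufficiently large this implies G = G₀(I − R)⁻¹»).
Displayed: `hE`, `hP1`, `hdef`∕`hdefT`, `hrest` (families 2–4 + the defect family), `hV′` (transposed families 2–4 + the defect family), bi-contractivity, the plaquette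
datum, `η = |c_f|⁻¹`, `0 ≤ b₁`, [4] Lemma 2.1, the two smallness conditions.  DEFECT LABEL: the defect families are an (R)-design term, NOT in print; `= 0` for
print's `G_□ = (Δ_{loc,□} − DP_□D*)⁻¹` on the cube sequence (p. 409 l. 3–5) and for r05's `GACubeY` letters.
[cite: Balaban1985BackgroundPropagators, Thm 3.3 p.399 (3.42) p.397 via Thm 3.10 pp.414–416, (3.105)–(3.106) p.414, (3.87) p.409, p.409 l.3–5, p.410 l.2–3; Balaban1984PropagatorsII, Prop. 2.2 (2.65)–(2.67) p.234, Lemma 2.1 (2.61) p.234] -/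
theorem eBlock_kernelFamilyBInv_GAY_of_localInverseCubes'' (hι : ∀ s, β i.hN i.D i.hk (ιB s) = s)
    {M₂ : ℝ} (hM₂ : 0 ≤ M₂) (hrepr : ∀ (v : 𝔸) (j : ι), |b.repr v j| ≤ M₂ * ‖v‖) (hη : etaS i = |i.cf|⁻¹) (hb₁ : 0 ≤ b₁)
    (parS : SiteParY 𝔸 i) (parB : BondParY 𝔸 i) (Gp : SiteOpY 𝔸 i)
    (ζ : ↥(cubes i.D.toDomains) → SiteY i → ℝ) (hζ : ∀ c z, hTY i c z ≠ 0 → ζ c z = 1)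
    (Oc : ↥(cubes i.D.toDomains) → BondOpY 𝔸 i) (Pl P1l E Et : ↥(cubes i.D.toDomains) → Module.End ℂ (FBondY i → 𝔸))
    (hP1 : ∀ c, Pl c * cutMulY (hBdY i (hTY i c)) = cutMulY (hBdY i (hTY i c)) * Pl c + P1l c)
    (hdef : ∀ c, cutMulY (hBdY i (hTY i c)) * (deltaLocY i parB (cfg U₁) - Pl c) * Oc c (cfg U₁) * cutMulY (hBdY i (hTY i c)) =
      cutMulY (hBdY i (hTY i c)) * cutMulY (hBdY i (hTY i c)) - E c)
    (hdefT : ∀ c, cutMulY (hBdY i (hTY i c)) * Oc c (cfg U₁) * (deltaLocY i parB (cfg U₁) - Pl c) * cutMulY (hBdY i (hTY i c)) =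
      cutMulY (hBdY i (hTY i c)) * cutMulY (hBdY i (hTY i c)) - Et c)
    (D Ds : Fin (d + 1) → Module.End ℝ (FBondY i → 𝔸)) (hD : ∀ ν Λ, D ν Λ = cdB i (cfg U₁) ν Λ) (hDs : ∀ ν Λ, Ds ν Λ = cdsB i (cfg U₁) ν Λ)
    (Lp : Module.End ℝ (FBondY i → 𝔸)) (hLp : ∀ Λ, Lp Λ = lapB i (cfg U₁) Λ)
    (d' : ℕ) {δ₀ α Θ' θV' B₀ δh : ℝ}
    (hB₀ : 0 ≤ B₀) (hδ₀ : 0 ≤ δ₀) (hΘ' : 0 ≤ Θ') (hθV' : 0 ≤ θV') (hδh : 0 ≤ δh)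
    (hαδ : 0 ≤ α * δ₀) (hαδ2 : 0 ≤ (1 - 2 * α) * δ₀)
    (h261 : Ineq261 d' (toB6 (geo9K i) Rr Hp) δ₀ α) (h263 : Ineq263 d' (toB6 (geo9K i) Rr Hp) δ₀ α)
    (hsmall : ((3 * 5 ^ (d + 1) * (Real.exp (α * δ₀ * (2 * (ℓ : ℝ) + 6)) * B6.c1 d' δ₀ α)) *
        (M₂ * (∑ j, ‖b j‖) * theta389B d ℓ B₀ b₁ δ₀ 1 (2 * δh) (δh * (((ℓ : ℝ) + 1) ^ 2 + 1)) δh 0 * ((geo9K i).M)⁻¹) + Θ') * B6.c1 d' δ₀ α < 1)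
    (hsmallV : ((3 * 5 ^ (d + 1) * (Real.exp (α * δ₀ * (2 * (ℓ : ℝ) + 6)) * B6.c1 d' δ₀ α)) *
          (M₂ * (∑ j, ‖b j‖) *
            ((B₀ * (((d : ℝ) + 1) * (Real.exp (α * δ₀ * 2) * B6.c1 d' δ₀ α) * Real.exp (δ₀ * 2)
                * ((2 * ((d : ℝ) + 1) + 4) * (5 / 8 * C1F d ℓ / i.Mh) + (5 / 8) ^ 2 * (C2F d ℓ + 2 * C2X d ℓ) / (i.Mh : ℝ) ^ 2
                    + 8 * δh * ((ℓ : ℝ) + 1) ^ 5 * (5 / 8 * C1F d ℓ / i.Mh) + 64 * δh * ((ℓ : ℝ) + 1) ^ 7 * (5 / 8 * C1F d ℓ / i.Mh))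
              + (Real.exp (α * δ₀ * (2 * (ℓ : ℝ) + 6)) * B6.c1 d' δ₀ α) * Real.exp (δ₀ * (2 * (ℓ : ℝ) + 6))
                * (4 * b₁ * ((ℓ : ℝ) + 1) ^ 6 * (((ℓ : ℝ) + 1) ^ (d + 1)) ^ 5 * (sLipT d ℓ / (((ℓ : ℝ) + 1) * i.Mh) * (((ℓ : ℝ) + 1) + 3)))))
              * ((ℓ : ℝ) + 1) ^ 5)) + θV') * B6.c1 d' δ₀ α < 1)
    (hE : ∀ c : ↥(cubes i.D.toDomains), EBlock (kernelFamilyBInv i B cfg (Oc c) par) B₀ δ₀ U₁)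
    (hU : ∀ μ x, ‖(cfg U₁ μ x : 𝔸)‖ ≤ 1 ∧ ‖(((cfg U₁ μ x)⁻¹ : 𝔸ˣ) : 𝔸)‖ ≤ 1)
    (hT : ∀ (y : IBondY i) (f : FBondY i), ‖(qT i parB (cfg U₁) y f : 𝔸)‖ ≤ 1 ∧ ‖(((qT i parB (cfg U₁) y f)⁻¹ : 𝔸ˣ) : 𝔸)‖ ≤ 1)
    (hW : ∀ p : PlaqY i, ‖((holY i (cfg U₁) p : 𝔸ˣ) : 𝔸) - 1‖ ≤ δh * ((((ℓ : ℝ) + 1) ^ levY i (chartY i p.src))⁻¹) ^ 2)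
    (hrest : HasMajorant (g := toB6 (geo9K i) Rr Hp) (fun p : FBondY i × ι => ιB (blkV1 i.hN i.D p.1))
      (∑ c, conj b (((1 - cutMulY (hBdY i (ζ c))) * DPDsY i parS Gp (cfg U₁) *
            (cutMulY (hBdY i (hTY i c)) * Oc c (cfg U₁) * cutMulY (hBdY i (hTY i c)))).restrictScalars ℝ)
        + ∑ c, conj b ((cutMulY (hBdY i (ζ c)) * (DPDsY i parS Gp (cfg U₁) - Pl c) *
            (cutMulY (hBdY i (hTY i c)) * Oc c (cfg U₁) * cutMulY (hBdY i (hTY i c)))).restrictScalars ℝ)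
        + ∑ c, conj b ((cutMulY (hBdY i (ζ c)) * P1l c * Oc c (cfg U₁) * cutMulY (hBdY i (hTY i c))).restrictScalars ℝ)
        + ∑ c, conj b ((E c).restrictScalars ℝ))
      (fun a a' => Θ' * Real.exp (-(δ₀ * (geo9K i).dist a a'))))
    (hV' : HasMajorant (g := toB6 (geo9K i) Rr Hp) (fun p : FBondY i × ι => ιB (blkV1 i.hN i.D p.1))
      (-(∑ c, conj b ((cutMulY (hBdY i (hTY i c)) * Oc c (cfg U₁) * P1l c).restrictScalars ℝ))
        + ∑ c, conj b ((cutMulY (hBdY i (hTY i c)) * Oc c (cfg U₁) * cutMulY (hBdY i (hTY i c)) *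
            (cutMulY (hBdY i (ζ c)) * (DPDsY i parS Gp (cfg U₁) - Pl c))).restrictScalars ℝ)
        + ∑ c, conj b ((cutMulY (hBdY i (hTY i c)) * Oc c (cfg U₁) * cutMulY (hBdY i (hTY i c)) *
            ((1 - cutMulY (hBdY i (ζ c))) * DPDsY i parS Gp (cfg U₁))).restrictScalars ℝ)
        + ∑ c, conj b ((Et c).restrictScalars ℝ))
      (fun a a' => θV' * (geo9K i).len a * ((geo9K i).len a')⁻¹ * Real.exp (-(δ₀ * (geo9K i).dist a a')))) :
    EBlock (kernelFamilyBInv i B cfg (GAY i parS parB Gp) par)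
      (M₂ * (∑ j, ‖b j‖) *
        ((3 * 5 ^ (d + 1)) * (M₂ * (∑ j, ‖b j‖) * B₀) * B6.c1 d' δ₀ α *
            (1 - ((3 * 5 ^ (d + 1) * (Real.exp (α * δ₀ * (2 * (ℓ : ℝ) + 6)) * B6.c1 d' δ₀ α)) *
              (M₂ * (∑ j, ‖b j‖) * theta389B d ℓ B₀ b₁ δ₀ 1 (2 * δh) (δh * (((ℓ : ℝ) + 1) ^ 2 + 1)) δh 0 * ((geo9K i).M)⁻¹) + Θ') *
              B6.c1 d' δ₀ α)⁻¹ +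
          ((3 * 5 ^ (d + 1) * (Real.exp (α * δ₀ * (2 * (ℓ : ℝ) + 6)) * B6.c1 d' δ₀ α)) *
              (M₂ * (∑ j, ‖b j‖) * (B₀ * (1 + 5 * C1F d ℓ * (((ℓ : ℝ) + 1) * Real.exp δ₀) / (8 * (i.Mh : ℝ)))))) * B6.c1 d' δ₀ α *
            (1 - ((3 * 5 ^ (d + 1) * (Real.exp (α * δ₀ * (2 * (ℓ : ℝ) + 6)) * B6.c1 d' δ₀ α)) *
              (M₂ * (∑ j, ‖b j‖) * theta389B d ℓ B₀ b₁ δ₀ 1 (2 * δh) (δh * (((ℓ : ℝ) + 1) ^ 2 + 1)) δh 0 * ((geo9K i).M)⁻¹) + Θ') *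
              B6.c1 d' δ₀ α)⁻¹ +
          ((3 * 5 ^ (d + 1) * (Real.exp (α * δ₀ * (2 * (ℓ : ℝ) + 6)) * B6.c1 d' δ₀ α)) *
              (M₂ * (∑ j, ‖b j‖) * (B₀ * (1 + Real.exp (α * δ₀) * B6.c1 d' δ₀ α * Real.exp δ₀ * (5 / 8 * C1F d ℓ / i.Mh))))) * B6.c1 d' δ₀ α *
            (1 - ((3 * 5 ^ (d + 1) * (Real.exp (α * δ₀ * (2 * (ℓ : ℝ) + 6)) * B6.c1 d' δ₀ α)) *
                (M₂ * (∑ j, ‖b j‖) *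
                  ((B₀ * (((d : ℝ) + 1) * (Real.exp (α * δ₀ * 2) * B6.c1 d' δ₀ α) * Real.exp (δ₀ * 2)
                      * ((2 * ((d : ℝ) + 1) + 4) * (5 / 8 * C1F d ℓ / i.Mh) + (5 / 8) ^ 2 * (C2F d ℓ + 2 * C2X d ℓ) / (i.Mh : ℝ) ^ 2
                          + 8 * δh * ((ℓ : ℝ) + 1) ^ 5 * (5 / 8 * C1F d ℓ / i.Mh) + 64 * δh * ((ℓ : ℝ) + 1) ^ 7 * (5 / 8 * C1F d ℓ / i.Mh))
                    + (Real.exp (α * δ₀ * (2 * (ℓ : ℝ) + 6)) * B6.c1 d' δ₀ α) * Real.exp (δ₀ * (2 * (ℓ : ℝ) + 6))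
                      * (4 * b₁ * ((ℓ : ℝ) + 1) ^ 6 * (((ℓ : ℝ) + 1) ^ (d + 1)) ^ 5 * (sLipT d ℓ / (((ℓ : ℝ) + 1) * i.Mh) * (((ℓ : ℝ) + 1) + 3)))))
                    * ((ℓ : ℝ) + 1) ^ 5)) + θV') * B6.c1 d' δ₀ α)⁻¹ +
          ((3 * 5 ^ (d + 1) * (Real.exp (α * δ₀ * (2 * (ℓ : ℝ) + 6)) * B6.c1 d' δ₀ α)) *
              (M₂ * (∑ j, ‖b j‖) * (B₀ * (1 + ((d : ℝ) + 1) * (5 / 8 * C1F d ℓ / i.Mh * (Real.exp δ₀ + 1) + 25 / 64 * C2F d ℓ / i.Mh ^ 2))))) * B6.c1 d' δ₀ α *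
            (1 - ((3 * 5 ^ (d + 1) * (Real.exp (α * δ₀ * (2 * (ℓ : ℝ) + 6)) * B6.c1 d' δ₀ α)) *
              (M₂ * (∑ j, ‖b j‖) * theta389B d ℓ B₀ b₁ δ₀ 1 (2 * δh) (δh * (((ℓ : ℝ) + 1) ^ 2 + 1)) δh 0 * ((geo9K i).M)⁻¹) + Θ') *
              B6.c1 d' δ₀ α)⁻¹))
      ((1 - 2 * α) * δ₀) U₁ := by
  have hαδ1 : 0 ≤ (1 - α) * δ₀ := by linarith
  exact eBlock_kernelFamilyBInv_GAY_of_localInverseCubes' i b ιB cfg par hι hM₂ hrepr hη hb₁ parS parB Gp ζ hζ Oc Pl P1l E Et hP1 hdef hdefT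
    (isUnit_deltaAY_of_localInverse i b ιB cfg par hι hM₂ hrepr hη hb₁ d' parS parB Gp ζ hζ Oc Pl P1l E hP1 hdef hB₀ hδ₀ hΘ' hδh hαδ hαδ1 h261
      hsmall hE hU hT hW hrest)
    D Ds hD hDs Lp hLp d' hB₀ hδ₀ hΘ' hθV' hδh hαδ hαδ2 h261 h263 hsmall hsmallV hE hU hT hW hrest hV'

/-- ★★★ **THE EXACT-LAW ENDPOINT WITH `hinvU` DISCHARGED**: `…localInverseCubes'_exact` without the displayed `IsUnit (Δ_a(U₁))` (§2 at `E ≡ 0`).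
[cite: Balaban1985BackgroundPropagators, Thm 3.3 p.399 (3.42) p.397 via Thm 3.10 pp.414–416, (3.105)–(3.106) p.414, (3.87) p.409, p.409 l.3–5; Balaban1984PropagatorsII, Prop. 2.2 (2.65)–(2.67) p.234] -/
theorem eBlock_kernelFamilyBInv_GAY_of_localInverseCubes''_exact (hι : ∀ s, β i.hN i.D i.hk (ιB s) = s)
    {M₂ : ℝ} (hM₂ : 0 ≤ M₂) (hrepr : ∀ (v : 𝔸) (j : ι), |b.repr v j| ≤ M₂ * ‖v‖) (hη : etaS i = |i.cf|⁻¹) (hb₁ : 0 ≤ b₁)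
    (parS : SiteParY 𝔸 i) (parB : BondParY 𝔸 i) (Gp : SiteOpY 𝔸 i)
    (ζ : ↥(cubes i.D.toDomains) → SiteY i → ℝ) (hζ : ∀ c z, hTY i c z ≠ 0 → ζ c z = 1)
    (Oc : ↥(cubes i.D.toDomains) → BondOpY 𝔸 i) (Pl P1l : ↥(cubes i.D.toDomains) → Module.End ℂ (FBondY i → 𝔸))
    (hP1 : ∀ c, Pl c * cutMulY (hBdY i (hTY i c)) = cutMulY (hBdY i (hTY i c)) * Pl c + P1l c)
    (hloc : ∀ c, cutMulY (hBdY i (hTY i c)) * (deltaLocY i parB (cfg U₁) - Pl c) * Oc c (cfg U₁) * cutMulY (hBdY i (hTY i c)) =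
      cutMulY (hBdY i (hTY i c)) * cutMulY (hBdY i (hTY i c)))
    (hlocT : ∀ c, cutMulY (hBdY i (hTY i c)) * Oc c (cfg U₁) * (deltaLocY i parB (cfg U₁) - Pl c) * cutMulY (hBdY i (hTY i c)) =
      cutMulY (hBdY i (hTY i c)) * cutMulY (hBdY i (hTY i c)))
    (D Ds : Fin (d + 1) → Module.End ℝ (FBondY i → 𝔸)) (hD : ∀ ν Λ, D ν Λ = cdB i (cfg U₁) ν Λ) (hDs : ∀ ν Λ, Ds ν Λ = cdsB i (cfg U₁) ν Λ)
    (Lp : Module.End ℝ (FBondY i → 𝔸)) (hLp : ∀ Λ, Lp Λ = lapB i (cfg U₁) Λ)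
    (d' : ℕ) {δ₀ α Θ' θV' B₀ δh : ℝ}
    (hB₀ : 0 ≤ B₀) (hδ₀ : 0 ≤ δ₀) (hΘ' : 0 ≤ Θ') (hθV' : 0 ≤ θV') (hδh : 0 ≤ δh)
    (hαδ : 0 ≤ α * δ₀) (hαδ2 : 0 ≤ (1 - 2 * α) * δ₀)
    (h261 : Ineq261 d' (toB6 (geo9K i) Rr Hp) δ₀ α) (h263 : Ineq263 d' (toB6 (geo9K i) Rr Hp) δ₀ α)
    (hsmall : ((3 * 5 ^ (d + 1) * (Real.exp (α * δ₀ * (2 * (ℓ : ℝ) + 6)) * B6.c1 d' δ₀ α)) *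
        (M₂ * (∑ j, ‖b j‖) * theta389B d ℓ B₀ b₁ δ₀ 1 (2 * δh) (δh * (((ℓ : ℝ) + 1) ^ 2 + 1)) δh 0 * ((geo9K i).M)⁻¹) + Θ') * B6.c1 d' δ₀ α < 1)
    (hsmallV : ((3 * 5 ^ (d + 1) * (Real.exp (α * δ₀ * (2 * (ℓ : ℝ) + 6)) * B6.c1 d' δ₀ α)) *
          (M₂ * (∑ j, ‖b j‖) *
            ((B₀ * (((d : ℝ) + 1) * (Real.exp (α * δ₀ * 2) * B6.c1 d' δ₀ α) * Real.exp (δ₀ * 2)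
                * ((2 * ((d : ℝ) + 1) + 4) * (5 / 8 * C1F d ℓ / i.Mh) + (5 / 8) ^ 2 * (C2F d ℓ + 2 * C2X d ℓ) / (i.Mh : ℝ) ^ 2
                    + 8 * δh * ((ℓ : ℝ) + 1) ^ 5 * (5 / 8 * C1F d ℓ / i.Mh) + 64 * δh * ((ℓ : ℝ) + 1) ^ 7 * (5 / 8 * C1F d ℓ / i.Mh))
              + (Real.exp (α * δ₀ * (2 * (ℓ : ℝ) + 6)) * B6.c1 d' δ₀ α) * Real.exp (δ₀ * (2 * (ℓ : ℝ) + 6))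
                * (4 * b₁ * ((ℓ : ℝ) + 1) ^ 6 * (((ℓ : ℝ) + 1) ^ (d + 1)) ^ 5 * (sLipT d ℓ / (((ℓ : ℝ) + 1) * i.Mh) * (((ℓ : ℝ) + 1) + 3)))))
              * ((ℓ : ℝ) + 1) ^ 5)) + θV') * B6.c1 d' δ₀ α < 1)
    (hE : ∀ c : ↥(cubes i.D.toDomains), EBlock (kernelFamilyBInv i B cfg (Oc c) par) B₀ δ₀ U₁)
    (hU : ∀ μ x, ‖(cfg U₁ μ x : 𝔸)‖ ≤ 1 ∧ ‖(((cfg U₁ μ x)⁻¹ : 𝔸ˣ) : 𝔸)‖ ≤ 1)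
    (hT : ∀ (y : IBondY i) (f : FBondY i), ‖(qT i parB (cfg U₁) y f : 𝔸)‖ ≤ 1 ∧ ‖(((qT i parB (cfg U₁) y f)⁻¹ : 𝔸ˣ) : 𝔸)‖ ≤ 1)
    (hW : ∀ p : PlaqY i, ‖((holY i (cfg U₁) p : 𝔸ˣ) : 𝔸) - 1‖ ≤ δh * ((((ℓ : ℝ) + 1) ^ levY i (chartY i p.src))⁻¹) ^ 2)
    (hrest : HasMajorant (g := toB6 (geo9K i) Rr Hp) (fun p : FBondY i × ι => ιB (blkV1 i.hN i.D p.1))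
      (∑ c, conj b (((1 - cutMulY (hBdY i (ζ c))) * DPDsY i parS Gp (cfg U₁) *
            (cutMulY (hBdY i (hTY i c)) * Oc c (cfg U₁) * cutMulY (hBdY i (hTY i c)))).restrictScalars ℝ)
        + ∑ c, conj b ((cutMulY (hBdY i (ζ c)) * (DPDsY i parS Gp (cfg U₁) - Pl c) *
            (cutMulY (hBdY i (hTY i c)) * Oc c (cfg U₁) * cutMulY (hBdY i (hTY i c)))).restrictScalars ℝ)
        + ∑ c, conj b ((cutMulY (hBdY i (ζ c)) * P1l c * Oc c (cfg U₁) * cutMulY (hBdY i (hTY i c))).restrictScalars ℝ))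
      (fun a a' => Θ' * Real.exp (-(δ₀ * (geo9K i).dist a a'))))
    (hV' : HasMajorant (g := toB6 (geo9K i) Rr Hp) (fun p : FBondY i × ι => ιB (blkV1 i.hN i.D p.1))
      (-(∑ c, conj b ((cutMulY (hBdY i (hTY i c)) * Oc c (cfg U₁) * P1l c).restrictScalars ℝ))
        + ∑ c, conj b ((cutMulY (hBdY i (hTY i c)) * Oc c (cfg U₁) * cutMulY (hBdY i (hTY i c)) *
            (cutMulY (hBdY i (ζ c)) * (DPDsY i parS Gp (cfg U₁) - Pl c))).restrictScalars ℝ)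
        + ∑ c, conj b ((cutMulY (hBdY i (hTY i c)) * Oc c (cfg U₁) * cutMulY (hBdY i (hTY i c)) *
            ((1 - cutMulY (hBdY i (ζ c))) * DPDsY i parS Gp (cfg U₁))).restrictScalars ℝ))
      (fun a a' => θV' * (geo9K i).len a * ((geo9K i).len a')⁻¹ * Real.exp (-(δ₀ * (geo9K i).dist a a')))) :
    EBlock (kernelFamilyBInv i B cfg (GAY i parS parB Gp) par)
      (M₂ * (∑ j, ‖b j‖) *
        ((3 * 5 ^ (d + 1)) * (M₂ * (∑ j, ‖b j‖) * B₀) * B6.c1 d' δ₀ α *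
            (1 - ((3 * 5 ^ (d + 1) * (Real.exp (α * δ₀ * (2 * (ℓ : ℝ) + 6)) * B6.c1 d' δ₀ α)) *
              (M₂ * (∑ j, ‖b j‖) * theta389B d ℓ B₀ b₁ δ₀ 1 (2 * δh) (δh * (((ℓ : ℝ) + 1) ^ 2 + 1)) δh 0 * ((geo9K i).M)⁻¹) + Θ') *
              B6.c1 d' δ₀ α)⁻¹ +
          ((3 * 5 ^ (d + 1) * (Real.exp (α * δ₀ * (2 * (ℓ : ℝ) + 6)) * B6.c1 d' δ₀ α)) *
              (M₂ * (∑ j, ‖b j‖) * (B₀ * (1 + 5 * C1F d ℓ * (((ℓ : ℝ) + 1) * Real.exp δ₀) / (8 * (i.Mh : ℝ)))))) * B6.c1 d' δ₀ α *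
            (1 - ((3 * 5 ^ (d + 1) * (Real.exp (α * δ₀ * (2 * (ℓ : ℝ) + 6)) * B6.c1 d' δ₀ α)) *
              (M₂ * (∑ j, ‖b j‖) * theta389B d ℓ B₀ b₁ δ₀ 1 (2 * δh) (δh * (((ℓ : ℝ) + 1) ^ 2 + 1)) δh 0 * ((geo9K i).M)⁻¹) + Θ') *
              B6.c1 d' δ₀ α)⁻¹ +
          ((3 * 5 ^ (d + 1) * (Real.exp (α * δ₀ * (2 * (ℓ : ℝ) + 6)) * B6.c1 d' δ₀ α)) *
              (M₂ * (∑ j, ‖b j‖) * (B₀ * (1 + Real.exp (α * δ₀) * B6.c1 d' δ₀ α * Real.exp δ₀ * (5 / 8 * C1F d ℓ / i.Mh))))) * B6.c1 d' δ₀ α *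
            (1 - ((3 * 5 ^ (d + 1) * (Real.exp (α * δ₀ * (2 * (ℓ : ℝ) + 6)) * B6.c1 d' δ₀ α)) *
                (M₂ * (∑ j, ‖b j‖) *
                  ((B₀ * (((d : ℝ) + 1) * (Real.exp (α * δ₀ * 2) * B6.c1 d' δ₀ α) * Real.exp (δ₀ * 2)
                      * ((2 * ((d : ℝ) + 1) + 4) * (5 / 8 * C1F d ℓ / i.Mh) + (5 / 8) ^ 2 * (C2F d ℓ + 2 * C2X d ℓ) / (i.Mh : ℝ) ^ 2
                          + 8 * δh * ((ℓ : ℝ) + 1) ^ 5 * (5 / 8 * C1F d ℓ / i.Mh) + 64 * δh * ((ℓ : ℝ) + 1) ^ 7 * (5 / 8 * C1F d ℓ / i.Mh))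
                    + (Real.exp (α * δ₀ * (2 * (ℓ : ℝ) + 6)) * B6.c1 d' δ₀ α) * Real.exp (δ₀ * (2 * (ℓ : ℝ) + 6))
                      * (4 * b₁ * ((ℓ : ℝ) + 1) ^ 6 * (((ℓ : ℝ) + 1) ^ (d + 1)) ^ 5 * (sLipT d ℓ / (((ℓ : ℝ) + 1) * i.Mh) * (((ℓ : ℝ) + 1) + 3)))))
                    * ((ℓ : ℝ) + 1) ^ 5)) + θV') * B6.c1 d' δ₀ α)⁻¹ +
          ((3 * 5 ^ (d + 1) * (Real.exp (α * δ₀ * (2 * (ℓ : ℝ) + 6)) * B6.c1 d' δ₀ α)) *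
              (M₂ * (∑ j, ‖b j‖) * (B₀ * (1 + ((d : ℝ) + 1) * (5 / 8 * C1F d ℓ / i.Mh * (Real.exp δ₀ + 1) + 25 / 64 * C2F d ℓ / i.Mh ^ 2))))) * B6.c1 d' δ₀ α *
            (1 - ((3 * 5 ^ (d + 1) * (Real.exp (α * δ₀ * (2 * (ℓ : ℝ) + 6)) * B6.c1 d' δ₀ α)) *
              (M₂ * (∑ j, ‖b j‖) * theta389B d ℓ B₀ b₁ δ₀ 1 (2 * δh) (δh * (((ℓ : ℝ) + 1) ^ 2 + 1)) δh 0 * ((geo9K i).M)⁻¹) + Θ') *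
              B6.c1 d' δ₀ α)⁻¹))
      ((1 - 2 * α) * δ₀) U₁ := by
  have hαδ1 : 0 ≤ (1 - α) * δ₀ := by linarith
  have h0 : (∑ c : ↥(cubes i.D.toDomains), conj b (((fun _ : ↥(cubes i.D.toDomains) => (0 : Module.End ℂ (FBondY i → 𝔸))) c).restrictScalars ℝ)) = 0 := by
    simp only [LinearMap.restrictScalars_zero, B9Eq352DivFormLetters.conj, map_zero, Finset.sum_const_zero]
  refine eBlock_kernelFamilyBInv_GAY_of_localInverseCubes'_exact i b ιB cfg par hι hM₂ hrepr hη hb₁ parS parB Gp ζ hζ Oc Pl P1l hP1 hloc hlocT ?_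
    D Ds hD hDs Lp hLp d' hB₀ hδ₀ hΘ' hθV' hδh hαδ hαδ2 h261 h263 hsmall hsmallV hE hU hT hW hrest hV'
  refine isUnit_deltaAY_of_localInverse i b ιB cfg par hι hM₂ hrepr hη hb₁ d' parS parB Gp ζ hζ Oc Pl P1l (fun _ => 0) hP1
    (fun c => by rw [hloc c, sub_zero]) hB₀ hδ₀ hΘ' hδh hαδ hαδ1 h261 hsmall hE hU hT hW ?_
  rw [h0, add_zero]
  exact hrest

end Endpoint

/-! ## §4 (v1.1) At r05's whole-torus cube letters `GACubeY` — the consumer shape of record -/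

section CoverCubes

/-- ★★ **`IsUnit (Δ_a(U₁))` AT r05's LETTERS**: §2 at `O_□ := G_{a,□} = Δ_{a,□}(U₁)⁻¹` (`B9CubeLettersBondOpsL0.GACubeY`), `P_□ := DP_□D*` (`DPDsCubeY`),
`P_{□,1} := P_{□,1}(∂h_□)` (`P1CubeY`), zero defect: displayed are `hinvC : ∀ □, IsUnit Δ_{a,□}(U₁)` (whence the exact left law, `B9Eq3105OfLocalInverse.hdef_GACubeY`;
the (3.101) law is `hP1_DPDsCubeY`), the letters' (3.42) blocks `hE`, bi-contractivity, `η = |c_f|⁻¹`, the plaquette datum, families 2–4 of `R` (`hrest`, the shape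
displayed by `B9Thm310TransposedCommutatorBMajorant.eBlock_kernelFamilyBInv_GAY_of_coverCubes'`), [4] (2.61), `(Θ₁ + Θ′)c₁(α) < 1` — and the conclusion is the
`IsUnit (deltaAY i parS parB Gp (cfg U₁))` binder of def-Y-side consumers (e.g. `B8Eq158AtLettersY.eq158_atLettersY`).
[cite: Balaban1985BackgroundPropagators, (3.106) p.414, (3.105) p.414, Thm 3.10 p.416, (3.27) p.395, (3.87) p.409, p.409 l.3–5; Balaban1984PropagatorsII, (2.61) p.234, (2.66) p.234] -/
theorem isUnit_deltaAY_of_coverCubes (hι : ∀ s, β i.hN i.D i.hk (ιB s) = s)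
    {M₂ : ℝ} (hM₂ : 0 ≤ M₂) (hrepr : ∀ (v : 𝔸) (j : ι), |b.repr v j| ≤ M₂ * ‖v‖) (hη : etaS i = |i.cf|⁻¹) (hb₁ : 0 ≤ b₁)
    (d' : ℕ) {δ₀ α Θ' B₀ δh : ℝ}
    (parS : SiteParY 𝔸 i) (parB : BondParY 𝔸 i) (Gp : SiteOpY 𝔸 i)
    (ζ : ↥(cubes i.D.toDomains) → SiteY i → ℝ) (hζ : ∀ c z, hTY i c z ≠ 0 → ζ c z = 1)
    (hinvC : ∀ c : ↥(cubes i.D.toDomains), IsUnit (deltaACubeY i c parS parB (cfg U₁)))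
    (hB₀ : 0 ≤ B₀) (hδ₀ : 0 ≤ δ₀) (hΘ' : 0 ≤ Θ') (hδh : 0 ≤ δh) (hαδ : 0 ≤ α * δ₀) (hαδ1 : 0 ≤ (1 - α) * δ₀)
    (h261 : Ineq261 d' (toB6 (geo9K i) Rr Hp) δ₀ α)
    (hsmall : ((3 * 5 ^ (d + 1) * (Real.exp (α * δ₀ * (2 * (ℓ : ℝ) + 6)) * B6.c1 d' δ₀ α)) *
        (M₂ * (∑ j, ‖b j‖) * theta389B d ℓ B₀ b₁ δ₀ 1 (2 * δh) (δh * (((ℓ : ℝ) + 1) ^ 2 + 1)) δh 0 * ((geo9K i).M)⁻¹) + Θ') * B6.c1 d' δ₀ α < 1)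
    (hE : ∀ c : ↥(cubes i.D.toDomains), EBlock (kernelFamilyBInv i B cfg (GACubeY i c parS parB) par) B₀ δ₀ U₁)
    (hU : ∀ μ x, ‖(cfg U₁ μ x : 𝔸)‖ ≤ 1 ∧ ‖(((cfg U₁ μ x)⁻¹ : 𝔸ˣ) : 𝔸)‖ ≤ 1)
    (hT : ∀ (y : IBondY i) (f : FBondY i), ‖(qT i parB (cfg U₁) y f : 𝔸)‖ ≤ 1 ∧ ‖(((qT i parB (cfg U₁) y f)⁻¹ : 𝔸ˣ) : 𝔸)‖ ≤ 1)
    (hW : ∀ p : PlaqY i, ‖((holY i (cfg U₁) p : 𝔸ˣ) : 𝔸) - 1‖ ≤ δh * ((((ℓ : ℝ) + 1) ^ levY i (chartY i p.src))⁻¹) ^ 2)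
    (hrest : HasMajorant (g := toB6 (geo9K i) Rr Hp) (fun p : FBondY i × ι => ιB (blkV1 i.hN i.D p.1))
      (∑ c, conj b (((1 - cutMulY (hBdY i (ζ c))) * DPDsY i parS Gp (cfg U₁) *
            (cutMulY (hBdY i (hTY i c)) * GACubeY i c parS parB (cfg U₁) * cutMulY (hBdY i (hTY i c)))).restrictScalars ℝ)
        + ∑ c, conj b ((cutMulY (hBdY i (ζ c)) * (DPDsY i parS Gp (cfg U₁) - DPDsCubeY i c parS (cfg U₁)) *
            (cutMulY (hBdY i (hTY i c)) * GACubeY i c parS parB (cfg U₁) * cutMulY (hBdY i (hTY i c)))).restrictScalars ℝ)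
        + ∑ c, conj b ((cutMulY (hBdY i (ζ c)) * P1CubeY i c (hTY i c) parS (cfg U₁) * GACubeY i c parS parB (cfg U₁) *
            cutMulY (hBdY i (hTY i c))).restrictScalars ℝ))
      (fun a a' => Θ' * Real.exp (-(δ₀ * (geo9K i).dist a a')))) :
    IsUnit (deltaAY i parS parB Gp (cfg U₁)) := by
  have h0 : (∑ c : ↥(cubes i.D.toDomains), conj b (((fun _ : ↥(cubes i.D.toDomains) => (0 : Module.End ℂ (FBondY i → 𝔸))) c).restrictScalars ℝ)) = 0 := by
    simp only [LinearMap.restrictScalars_zero, B9Eq352DivFormLetters.conj, map_zero, Finset.sum_const_zero]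
  refine isUnit_deltaAY_of_localInverse i b ιB cfg par hι hM₂ hrepr hη hb₁ d' parS parB Gp ζ hζ (fun c => GACubeY i c parS parB)
    (fun c => DPDsCubeY i c parS (cfg U₁)) (fun c => P1CubeY i c (hTY i c) parS (cfg U₁)) (fun _ => 0) (fun c => hP1_DPDsCubeY i c parS (cfg U₁))
    (fun c => hdef_GACubeY i c parS parB (cfg U₁) (hinvC c)) hB₀ hδ₀ hΘ' hδh hαδ hαδ1 h261 hsmall hE hU hT hW ?_
  rw [h0, add_zero]
  exact hrest

/-- ★★★ **THE LANDED CONSUMER WITHOUT `hinvU`**: `B9Thm310TransposedCommutatorBMajorant.eBlock_kernelFamilyBInv_GAY_of_coverCubes'` — statement VERBATIM except that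
`hinvU : IsUnit (Δ_a(U₁))` is REMOVED — obtained from §3's `eBlock_kernelFamilyBInv_GAY_of_localInverseCubes''_exact` at `O_□ := GACubeY i □ parS parB`,
`P_□ := DPDsCubeY`, `P_{□,1} := P1CubeY`, the exact local-inverse laws supplied by `hinvC` through r05's `B9Eq3105AtLetters.hloc_GACubeY` ∕ `B9Eq3105TAtLetters.hlocT_GACubeY`
and the NearH rows ∕ columns agreements (`B9CubeBondRowAgreementNearH.QsaQCubeY_apply_eq_of_hT`, `B9Eq3105TAtLettersNearH.QsaQCubeY_cutMulY_hT_apply_eq`), the (3.101)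
law by `hP1_DPDsCubeY`.  This is at once the strengthened consumer of record for r05's def-Y road and the kernel-checked certificate that the (QB1) re-cut
generalises the landed consumer.  Displayed (as there): `hinvC`, `hE`, `hrest`, `hV′`, `hU`∕`hT`, `hW`, `η = |c_f|⁻¹`, `0 ≤ b₁`, [4] Lemma 2.1, the two smallness conditions.
[cite: Balaban1985BackgroundPropagators, Thm 3.3 p.399 (3.42) p.397 via Thm 3.10 pp.414–416, (3.105)–(3.106) p.414, (3.87) p.409, p.409 l.3–5, p.408 («Ω_n(□) ⊂ Ω_n»); Balaban1984PropagatorsII, Prop. 2.2 (2.65)–(2.67) p.234, Lemma 2.1 (2.61) p.234] -/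
theorem eBlock_kernelFamilyBInv_GAY_of_coverCubes'' (hι : ∀ s, β i.hN i.D i.hk (ιB s) = s)
    {M₂ : ℝ} (hM₂ : 0 ≤ M₂) (hrepr : ∀ (v : 𝔸) (j : ι), |b.repr v j| ≤ M₂ * ‖v‖) (hη : etaS i = |i.cf|⁻¹) (hb₁ : 0 ≤ b₁)
    (parS : SiteParY 𝔸 i) (parB : BondParY 𝔸 i) (Gp : SiteOpY 𝔸 i)
    (ζ : ↥(cubes i.D.toDomains) → SiteY i → ℝ) (hζ : ∀ c z, hTY i c z ≠ 0 → ζ c z = 1)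
    (hinvC : ∀ c : ↥(cubes i.D.toDomains), IsUnit (deltaACubeY i c parS parB (cfg U₁)))
    (D Ds : Fin (d + 1) → Module.End ℝ (FBondY i → 𝔸)) (hD : ∀ ν Λ, D ν Λ = cdB i (cfg U₁) ν Λ) (hDs : ∀ ν Λ, Ds ν Λ = cdsB i (cfg U₁) ν Λ)
    (Lp : Module.End ℝ (FBondY i → 𝔸)) (hLp : ∀ Λ, Lp Λ = lapB i (cfg U₁) Λ)
    (d' : ℕ) {δ₀ α Θ' θV' B₀ δh : ℝ}
    (hB₀ : 0 ≤ B₀) (hδ₀ : 0 ≤ δ₀) (hΘ' : 0 ≤ Θ') (hθV' : 0 ≤ θV') (hδh : 0 ≤ δh)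
    (hαδ : 0 ≤ α * δ₀) (hαδ2 : 0 ≤ (1 - 2 * α) * δ₀)
    (h261 : Ineq261 d' (toB6 (geo9K i) Rr Hp) δ₀ α) (h263 : Ineq263 d' (toB6 (geo9K i) Rr Hp) δ₀ α)
    (hsmall : ((3 * 5 ^ (d + 1) * (Real.exp (α * δ₀ * (2 * (ℓ : ℝ) + 6)) * B6.c1 d' δ₀ α)) *
        (M₂ * (∑ j, ‖b j‖) * theta389B d ℓ B₀ b₁ δ₀ 1 (2 * δh) (δh * (((ℓ : ℝ) + 1) ^ 2 + 1)) δh 0 * ((geo9K i).M)⁻¹) + Θ') * B6.c1 d' δ₀ α < 1)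
    (hsmallV : ((3 * 5 ^ (d + 1) * (Real.exp (α * δ₀ * (2 * (ℓ : ℝ) + 6)) * B6.c1 d' δ₀ α)) *
          (M₂ * (∑ j, ‖b j‖) *
            ((B₀ * (((d : ℝ) + 1) * (Real.exp (α * δ₀ * 2) * B6.c1 d' δ₀ α) * Real.exp (δ₀ * 2)
                * ((2 * ((d : ℝ) + 1) + 4) * (5 / 8 * C1F d ℓ / i.Mh) + (5 / 8) ^ 2 * (C2F d ℓ + 2 * C2X d ℓ) / (i.Mh : ℝ) ^ 2
                    + 8 * δh * ((ℓ : ℝ) + 1) ^ 5 * (5 / 8 * C1F d ℓ / i.Mh) + 64 * δh * ((ℓ : ℝ) + 1) ^ 7 * (5 / 8 * C1F d ℓ / i.Mh))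
              + (Real.exp (α * δ₀ * (2 * (ℓ : ℝ) + 6)) * B6.c1 d' δ₀ α) * Real.exp (δ₀ * (2 * (ℓ : ℝ) + 6))
                * (4 * b₁ * ((ℓ : ℝ) + 1) ^ 6 * (((ℓ : ℝ) + 1) ^ (d + 1)) ^ 5 * (sLipT d ℓ / (((ℓ : ℝ) + 1) * i.Mh) * (((ℓ : ℝ) + 1) + 3)))))
              * ((ℓ : ℝ) + 1) ^ 5)) + θV') * B6.c1 d' δ₀ α < 1)
    (hE : ∀ c : ↥(cubes i.D.toDomains), EBlock (kernelFamilyBInv i B cfg (GACubeY i c parS parB) par) B₀ δ₀ U₁)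
    (hU : ∀ μ x, ‖(cfg U₁ μ x : 𝔸)‖ ≤ 1 ∧ ‖(((cfg U₁ μ x)⁻¹ : 𝔸ˣ) : 𝔸)‖ ≤ 1)
    (hT : ∀ (y : IBondY i) (f : FBondY i), ‖(qT i parB (cfg U₁) y f : 𝔸)‖ ≤ 1 ∧ ‖(((qT i parB (cfg U₁) y f)⁻¹ : 𝔸ˣ) : 𝔸)‖ ≤ 1)
    (hW : ∀ p : PlaqY i, ‖((holY i (cfg U₁) p : 𝔸ˣ) : 𝔸) - 1‖ ≤ δh * ((((ℓ : ℝ) + 1) ^ levY i (chartY i p.src))⁻¹) ^ 2)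
    (hrest : HasMajorant (g := toB6 (geo9K i) Rr Hp) (fun p : FBondY i × ι => ιB (blkV1 i.hN i.D p.1))
      (∑ c, conj b (((1 - cutMulY (hBdY i (ζ c))) * DPDsY i parS Gp (cfg U₁) *
            (cutMulY (hBdY i (hTY i c)) * GACubeY i c parS parB (cfg U₁) * cutMulY (hBdY i (hTY i c)))).restrictScalars ℝ)
        + ∑ c, conj b ((cutMulY (hBdY i (ζ c)) * (DPDsY i parS Gp (cfg U₁) - DPDsCubeY i c parS (cfg U₁)) *
            (cutMulY (hBdY i (hTY i c)) * GACubeY i c parS parB (cfg U₁) * cutMulY (hBdY i (hTY i c)))).restrictScalars ℝ)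
        + ∑ c, conj b ((cutMulY (hBdY i (ζ c)) * P1CubeY i c (hTY i c) parS (cfg U₁) * GACubeY i c parS parB (cfg U₁) *
            cutMulY (hBdY i (hTY i c))).restrictScalars ℝ))
      (fun a a' => Θ' * Real.exp (-(δ₀ * (geo9K i).dist a a'))))
    (hV' : HasMajorant (g := toB6 (geo9K i) Rr Hp) (fun p : FBondY i × ι => ιB (blkV1 i.hN i.D p.1))
      (-(∑ c, conj b ((cutMulY (hBdY i (hTY i c)) * GACubeY i c parS parB (cfg U₁) * P1CubeY i c (hTY i c) parS (cfg U₁)).restrictScalars ℝ))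
        + ∑ c, conj b ((cutMulY (hBdY i (hTY i c)) * GACubeY i c parS parB (cfg U₁) * cutMulY (hBdY i (hTY i c)) *
            (cutMulY (hBdY i (ζ c)) * (DPDsY i parS Gp (cfg U₁) - DPDsCubeY i c parS (cfg U₁)))).restrictScalars ℝ)
        + ∑ c, conj b ((cutMulY (hBdY i (hTY i c)) * GACubeY i c parS parB (cfg U₁) * cutMulY (hBdY i (hTY i c)) *
            ((1 - cutMulY (hBdY i (ζ c))) * DPDsY i parS Gp (cfg U₁))).restrictScalars ℝ))
      (fun a a' => θV' * (geo9K i).len a * ((geo9K i).len a')⁻¹ * Real.exp (-(δ₀ * (geo9K i).dist a a')))) :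
    EBlock (kernelFamilyBInv i B cfg (GAY i parS parB Gp) par)
      (M₂ * (∑ j, ‖b j‖) *
        ((3 * 5 ^ (d + 1)) * (M₂ * (∑ j, ‖b j‖) * B₀) * B6.c1 d' δ₀ α *
            (1 - ((3 * 5 ^ (d + 1) * (Real.exp (α * δ₀ * (2 * (ℓ : ℝ) + 6)) * B6.c1 d' δ₀ α)) *
              (M₂ * (∑ j, ‖b j‖) * theta389B d ℓ B₀ b₁ δ₀ 1 (2 * δh) (δh * (((ℓ : ℝ) + 1) ^ 2 + 1)) δh 0 * ((geo9K i).M)⁻¹) + Θ') *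
              B6.c1 d' δ₀ α)⁻¹ +
          ((3 * 5 ^ (d + 1) * (Real.exp (α * δ₀ * (2 * (ℓ : ℝ) + 6)) * B6.c1 d' δ₀ α)) *
              (M₂ * (∑ j, ‖b j‖) * (B₀ * (1 + 5 * C1F d ℓ * (((ℓ : ℝ) + 1) * Real.exp δ₀) / (8 * (i.Mh : ℝ)))))) * B6.c1 d' δ₀ α *
            (1 - ((3 * 5 ^ (d + 1) * (Real.exp (α * δ₀ * (2 * (ℓ : ℝ) + 6)) * B6.c1 d' δ₀ α)) *
              (M₂ * (∑ j, ‖b j‖) * theta389B d ℓ B₀ b₁ δ₀ 1 (2 * δh) (δh * (((ℓ : ℝ) + 1) ^ 2 + 1)) δh 0 * ((geo9K i).M)⁻¹) + Θ') *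
              B6.c1 d' δ₀ α)⁻¹ +
          ((3 * 5 ^ (d + 1) * (Real.exp (α * δ₀ * (2 * (ℓ : ℝ) + 6)) * B6.c1 d' δ₀ α)) *
              (M₂ * (∑ j, ‖b j‖) * (B₀ * (1 + Real.exp (α * δ₀) * B6.c1 d' δ₀ α * Real.exp δ₀ * (5 / 8 * C1F d ℓ / i.Mh))))) * B6.c1 d' δ₀ α *
            (1 - ((3 * 5 ^ (d + 1) * (Real.exp (α * δ₀ * (2 * (ℓ : ℝ) + 6)) * B6.c1 d' δ₀ α)) *
                (M₂ * (∑ j, ‖b j‖) *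
                  ((B₀ * (((d : ℝ) + 1) * (Real.exp (α * δ₀ * 2) * B6.c1 d' δ₀ α) * Real.exp (δ₀ * 2)
                      * ((2 * ((d : ℝ) + 1) + 4) * (5 / 8 * C1F d ℓ / i.Mh) + (5 / 8) ^ 2 * (C2F d ℓ + 2 * C2X d ℓ) / (i.Mh : ℝ) ^ 2
                          + 8 * δh * ((ℓ : ℝ) + 1) ^ 5 * (5 / 8 * C1F d ℓ / i.Mh) + 64 * δh * ((ℓ : ℝ) + 1) ^ 7 * (5 / 8 * C1F d ℓ / i.Mh))
                    + (Real.exp (α * δ₀ * (2 * (ℓ : ℝ) + 6)) * B6.c1 d' δ₀ α) * Real.exp (δ₀ * (2 * (ℓ : ℝ) + 6))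
                      * (4 * b₁ * ((ℓ : ℝ) + 1) ^ 6 * (((ℓ : ℝ) + 1) ^ (d + 1)) ^ 5 * (sLipT d ℓ / (((ℓ : ℝ) + 1) * i.Mh) * (((ℓ : ℝ) + 1) + 3)))))
                    * ((ℓ : ℝ) + 1) ^ 5)) + θV') * B6.c1 d' δ₀ α)⁻¹ +
          ((3 * 5 ^ (d + 1) * (Real.exp (α * δ₀ * (2 * (ℓ : ℝ) + 6)) * B6.c1 d' δ₀ α)) *
              (M₂ * (∑ j, ‖b j‖) * (B₀ * (1 + ((d : ℝ) + 1) * (5 / 8 * C1F d ℓ / i.Mh * (Real.exp δ₀ + 1) + 25 / 64 * C2F d ℓ / i.Mh ^ 2))))) * B6.c1 d' δ₀ α *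
            (1 - ((3 * 5 ^ (d + 1) * (Real.exp (α * δ₀ * (2 * (ℓ : ℝ) + 6)) * B6.c1 d' δ₀ α)) *
              (M₂ * (∑ j, ‖b j‖) * theta389B d ℓ B₀ b₁ δ₀ 1 (2 * δh) (δh * (((ℓ : ℝ) + 1) ^ 2 + 1)) δh 0 * ((geo9K i).M)⁻¹) + Θ') *
              B6.c1 d' δ₀ α)⁻¹))
      ((1 - 2 * α) * δ₀) U₁ :=
  eBlock_kernelFamilyBInv_GAY_of_localInverseCubes''_exact i b ιB cfg par hι hM₂ hrepr hη hb₁ parS parB Gp ζ hζ (fun c => GACubeY i c parS parB)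
    (fun c => DPDsCubeY i c parS (cfg U₁)) (fun c => P1CubeY i c (hTY i c) parS (cfg U₁)) (fun c => hP1_DPDsCubeY i c parS (cfg U₁))
    (fun c => hloc_GACubeY i c parS parB (cfg U₁) (hTY i c) (hinvC c) fun A f hf => QsaQCubeY_apply_eq_of_hT i c parB (cfg U₁) A f hf)
    (fun c => hlocT_GACubeY i c parS parB (cfg U₁) (hTY i c) (hinvC c) fun A f => QsaQCubeY_cutMulY_hT_apply_eq i c parB (cfg U₁) A f)
    D Ds hD hDs Lp hLp d' hB₀ hδ₀ hΘ' hθV' hδh hαδ hαδ2 h261 h263 hsmall hsmallV hE hU hT hW hrest hV'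

end CoverCubes

end Literature.MathematicalPhysics.QuantumFieldTheory.Balaban1983to89.B9Thm310DeltaAIsUnitOfExpansion

end
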